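import Summits.QuantumFields.BalabanUV.Beta.RemainderExplicitHistoryDiagonalCriterion

/-!
# RemainderExplicitHistoryDiagonalPowerProfile — ROAD P3, STATION S-d4p3-g48-1, SIXTH FILE (annex): POWER PROFILES `ρ(a) = M∕(a+1)^p`
# WITH A REAL EXPONENT `p < 3∕2` VIOLATE THE CRITERION, so no pinned family of runs of their order-0 family has an m-uniform cutoff
# discrepancy — with the fourth file's half-moment corollary (`p > 3∕2`) and the fifth file's borderline (`p = 3∕2`) this closes
# «for power profiles, m-uniform IFF `p ≥ 3∕2`», against generation 47's conjectured `p > 2`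

Cell `pub-balaban`, β-function sub-cell, BINDER row D4 «RemainderConst leaves for Bałaban's split» (`HOME/BINDER-OWNERS.md`; owner
lineage `b2b-balaban-beta-an4`; this file by co-owner #3 lineage `b2b-balaban-beta-d4-p3`, road P3 «the reduction road», generation 48,
station S-d4p3-g48-1 «the cutoff discrepancy of the continuum coupling: two-sided law», sixth file (annex); imports the station's
fourth file `RemainderExplicitHistoryDiagonalCriterion`; Mathlib's `Real.rpow` for the real exponent), β-FLOW TEAM duty (1); FREEZE (0)
honoured (def-free module in road P3's own `RemainderExplicit*` series; no leaf, no interface, no Literature file).  SOURCE OF THE SHAPES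
ONLY: [Balaban1987RG1] (0.20) p. 256, (0.31) and Thm 2 p. 259, §5 p. 298.  Pure real analysis.

HONEST FRAMING (page 1 of everything the β sub-cell writes).  *"Discharging BetaPertH makes Bałaban's UV stability UNCONDITIONAL —
a real constructive-QFT result; it is NOT the continuum limit and NOT the Clay problem."*  THIS FILE DISCHARGES NOTHING OF THE
KIND.  It is [folklore] real analysis about road P3's ORDER-0 PROFILE FAMILY (ours).  Nothing of Bałaban's (1.22) is asserted or
constructed; row D4 class UNCHANGED (critical-path width 0; instance 0∕1; D4 DISCHARGE NO DATE); NOT B12 Thm 2, NOT BetaPertH, NOT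
continuum, NOT Clay.  HONEST DEPENDENCY: continuum YM on T⁴ ⇐ BetaPertH ∧ nine spine estimates (0/9 proved); BetaPertH ⇐ (D1) ∧ (D4) ∧
CAP+tail; G-an2-4 gates asym, D1 and NE2/3/4.  ABSOLUTE RULE: nothing is cited as a fact.  All letters NOT-IN-PRINT.

WHAT IS PROVED HERE ([folklore]; 0 sorry; 0 `def`).
* §1 **`powerProfile_violating`** (`ρ(a) = M∕(a+1)^p`, `M > 0`, real `0 ≤ p < 3∕2` ⟹ for every `C′` some `m ≥ 1`, `N` with
  `C′·m√m < Σ_{a<N} ρ(a)·min(a,m)²` — at `m = N = 4q²` the ages `[2q², 4q²)` give `8Mq⁶∕(4q²)^p` against `8C′q³`, and `q^{3−2p} → ∞`),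
  END **`powerProfile_not_uniform`** (every pinned family of runs of that order-0 family, `Σρ ≤ W`, `Wγ < b`: `¬∃ C, ∀ m, astar g m − invSq g m 0 ≤ C`).
-/

noncomputable section

open Finset Filter Topology

namespace Summit.QuantumFields.BalabanUV.Beta.RemainderExplicitHistoryDiagonalPowerProfile

open Literature.MathematicalPhysics.QuantumFieldTheory.Balaban1983to89
open Literature.MathematicalPhysics.QuantumFieldTheory.Balaban1983to89.FlowStep
open Literature.MathematicalPhysics.QuantumFieldTheory.Balaban1983to89.T4CouplingMatching
open Literature.MathematicalPhysics.QuantumFieldTheory.Balaban1983to89.T4ContinuumCoupling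
open Summit.QuantumFields.BalabanUV.Beta.RemainderExplicitHistoryDiagonalCriterion

variable {β : HBeta} {b γ W : ℝ} {ρ : ℕ → ℝ}

/-! ## §1 Power profiles `ρ(a) = M∕(a+1)^p` with a REAL exponent `p < 3∕2` violate the criterion -/

/-- **POWER PROFILES BELOW THE THRESHOLD VIOLATE THE CRITERION.**  For `ρ(a) = M∕(a+1)^p` (`M > 0`, real `0 ≤ p < 3∕2`) and every `C′`
there are `m ≥ 1` and `N` with `C′·m√m < Σ_{a<N} ρ(a)·min(a,m)²`: at `m = N = 4q²` the ages `a ∈ [2q², 4q²)` alone give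
`≥ 2q²·M·(2q²)²∕(4q²)^p = 8M·q⁶∕(4^p q^{2p})`, against `C′·m√m = 8C′q³`, and `q^{3−2p} → ∞`. [folklore] -/
theorem powerProfile_violating {M p : ℝ} (hM : 0 < M) (hp0 : 0 ≤ p) (hp : p < 3 / 2)
    (hρ : ∀ a, ρ a = M / ((a : ℝ) + 1) ^ p) (C' : ℝ) :
    ∃ m : ℕ, 1 ≤ m ∧ ∃ N, C' * ((m : ℝ) * Real.sqrt m) < ∑ a ∈ range N, ρ a * (min (a : ℝ) m) ^ 2 := by
  -- choose `q ≥ 1` with `q^{3−2p} > C′·4^p∕M`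
  have he : 0 < 3 - 2 * p := by linarith
  have ht : Tendsto (fun q : ℕ => ((q : ℝ)) ^ (3 - 2 * p)) atTop atTop :=
    (tendsto_rpow_atTop he).comp tendsto_natCast_atTop_atTop
  obtain ⟨q, hq⟩ := ((ht.eventually_gt_atTop (C' * (4 : ℝ) ^ p / M)).and (eventually_ge_atTop 1)).exists
  obtain ⟨hqC, hq1⟩ := hq
  have hqpos : (0 : ℝ) < q := by exact_mod_cast hq1
  refine ⟨4 * q ^ 2, by nlinarith [hq1], 4 * q ^ 2, ?_⟩
  -- `√(4q²) = 2q`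
  have hsq : Real.sqrt (((4 * q ^ 2 : ℕ) : ℝ)) = 2 * q := by
    push_cast
    rw [show (4 : ℝ) * (q : ℝ) ^ 2 = (2 * q) ^ 2 by ring, Real.sqrt_sq (by positivity)]
  rw [hsq]
  push_cast
  -- the ages `a ∈ [2q², 4q²)`: `ρ(a) ≥ M∕(4q²)^p` and `min(a, 4q²)² = a² ≥ (2q²)²`
  have h4p : 0 < ((4 : ℝ) * (q : ℝ) ^ 2) ^ p := Real.rpow_pos_of_pos (by positivity) p
  have hterm : ∀ a ∈ Ico (2 * q ^ 2) (4 * q ^ 2),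
      M / ((4 : ℝ) * (q : ℝ) ^ 2) ^ p * ((2 : ℝ) * (q : ℝ) ^ 2) ^ 2 ≤ ρ a * (min (a : ℝ) ((4 : ℝ) * (q : ℝ) ^ 2)) ^ 2 := by
    intro a ha
    obtain ⟨ha1, ha2⟩ := Finset.mem_Ico.mp ha
    have ha1r : (2 : ℝ) * (q : ℝ) ^ 2 ≤ a := by exact_mod_cast ha1
    have ha2r : (a : ℝ) + 1 ≤ 4 * (q : ℝ) ^ 2 := by exact_mod_cast ha2
    have ha0 : (0 : ℝ) ≤ a := Nat.cast_nonneg a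
    rw [min_eq_left (by linarith), hρ a]
    have hpow : ((a : ℝ) + 1) ^ p ≤ ((4 : ℝ) * (q : ℝ) ^ 2) ^ p := Real.rpow_le_rpow (by linarith) ha2r hp0
    have hpos : 0 < ((a : ℝ) + 1) ^ p := Real.rpow_pos_of_pos (by linarith) p
    have h1 : M / ((4 : ℝ) * (q : ℝ) ^ 2) ^ p ≤ M / ((a : ℝ) + 1) ^ p := div_le_div_of_nonneg_left hM.le hpos hpow
    have h2 : ((2 : ℝ) * (q : ℝ) ^ 2) ^ 2 ≤ (a : ℝ) ^ 2 := pow_le_pow_left₀ (by positivity) ha1r 2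
    exact mul_le_mul h1 h2 (by positivity) (by positivity)
  have hcard : ((Ico (2 * q ^ 2) (4 * q ^ 2)).card : ℝ) = 2 * (q : ℝ) ^ 2 := by
    rw [Nat.card_Ico, show 4 * q ^ 2 - 2 * q ^ 2 = 2 * q ^ 2 by omega]; push_cast; ring
  have hlow : (2 * (q : ℝ) ^ 2) * (M / ((4 : ℝ) * (q : ℝ) ^ 2) ^ p * ((2 : ℝ) * (q : ℝ) ^ 2) ^ 2)
      ≤ ∑ a ∈ range (4 * q ^ 2), ρ a * (min (a : ℝ) ((4 : ℝ) * (q : ℝ) ^ 2)) ^ 2 := by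
    have h1 := Finset.card_nsmul_le_sum _ _ _ hterm
    rw [nsmul_eq_mul, hcard] at h1
    refine h1.trans (Finset.sum_le_sum_of_subset_of_nonneg (fun a ha => Finset.mem_range.mpr (Finset.mem_Ico.mp ha).2) ?_)
    intro a _ _
    exact mul_nonneg (by rw [hρ a]; exact div_nonneg hM.le (Real.rpow_pos_of_pos (by positivity) p).le) (sq_nonneg _)
  refine lt_of_lt_of_le ?_ hlow
  -- `8C′q³ < 8M q⁶∕(4q²)^p`, i.e. `C′·4^p·q^{2p} < M·q³ = M·q^{3−2p}·q^{2p}`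
  have e4 : ((4 : ℝ) * (q : ℝ) ^ 2) ^ p = (4 : ℝ) ^ p * (q : ℝ) ^ (2 * p) := by
    rw [Real.mul_rpow (by norm_num) (by positivity), show ((q : ℝ) ^ 2) = (q : ℝ) ^ (2 : ℝ) by norm_cast,
      ← Real.rpow_mul hqpos.le]
  have e3 : (q : ℝ) ^ 3 = (q : ℝ) ^ (3 - 2 * p) * (q : ℝ) ^ (2 * p) := by
    rw [← Real.rpow_add hqpos, show 3 - 2 * p + 2 * p = (3 : ℝ) by ring]; norm_cast
  have hq2p : 0 < (q : ℝ) ^ (2 * p) := Real.rpow_pos_of_pos hqpos _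
  have h4 : 0 < (4 : ℝ) ^ p := Real.rpow_pos_of_pos (by norm_num) p
  -- from `hqC`: `C′·4^p < M·q^{3−2p}`
  have hkey : C' * (4 : ℝ) ^ p < M * (q : ℝ) ^ (3 - 2 * p) := by
    have := (div_lt_iff₀ hM).mp hqC
    linarith
  have hkey2 : C' * ((4 : ℝ) ^ p * (q : ℝ) ^ (2 * p)) < M * (q : ℝ) ^ 3 := by
    rw [e3]; nlinarith [mul_lt_mul_of_pos_right hkey hq2p]
  -- divide by `(4q²)^p` and multiply by `8q³`
  rw [show (2 : ℝ) * (q : ℝ) ^ 2 * (M / ((4 : ℝ) * (q : ℝ) ^ 2) ^ p * ((2 : ℝ) * (q : ℝ) ^ 2) ^ 2)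
      = 8 * (q : ℝ) ^ 3 * ((M * (q : ℝ) ^ 3) / ((4 : ℝ) * (q : ℝ) ^ 2) ^ p) by field_simp; ring]
  rw [show C' * ((4 : ℝ) * (q : ℝ) ^ 2 * (2 * q)) = 8 * (q : ℝ) ^ 3 * C' by ring]
  refine mul_lt_mul_of_pos_left ?_ (by positivity)
  rw [lt_div_iff₀ h4p, e4]
  exact hkey2

/-- **END — POWER PROFILES BELOW THE THRESHOLD ARE NOT m-UNIFORM.**  For road P3's order-0 family with `ρ(a) = M∕(a+1)^p`, REAL
`0 ≤ p < 3∕2` (`M > 0`, `Σ_{a<N} ρ_a ≤ W`, `Wγ < b`) and every family of its runs in ]0,γ] pinned at one `g_IR`: the cutoff discrepancy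
`astar g m − invSq g m 0` is NOT bounded uniformly in `m` (`uniform_iff_minSq` + `powerProfile_violating`).  Together with the fourth file's
half-moment corollary (`p > 3∕2`) and the annex's borderline (`p = 3∕2`): for power profiles m-uniformity holds IFF `p ≥ 3∕2` — not g47's
conjectured `p > 2`. [folklore] -/
theorem powerProfile_not_uniform
    (hβ : ∀ (k : ℕ) (p : Fin (k + 1) → ℝ),
      β k p = b + ∑ i : Fin (k + 1), ρ (k - i) * min (p (Fin.last k)) (|p (Fin.last k) - p i|))
    (hb : 0 < b) (hγ : 0 < γ) {M p : ℝ} (hM : 0 < M) (hp0 : 0 ≤ p) (hp : p < 3 / 2)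
    (hρ : ∀ a, ρ a = M / ((a : ℝ) + 1) ^ p) (hρW : ∀ n, ∑ a ∈ range n, ρ a ≤ W) (hsmall : W * γ < b)
    {g : ℕ → ℕ → ℝ} {gIR : ℝ} (hrun : ∀ K, RGEqH K β (g K)) (hbox : ∀ K i, i ≤ K → 0 < g K i ∧ g K i ≤ γ)
    (hpin : ∀ K, g K K = gIR) :
    ¬ ∃ C : ℝ, ∀ m : ℕ, astar g m - invSq g m 0 ≤ C := by
  have hρ0 : ∀ a, 0 ≤ ρ a := fun a => by
    rw [hρ a]; exact div_nonneg hM.le (Real.rpow_pos_of_pos (by positivity) p).le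
  intro hC
  obtain ⟨C', hC'⟩ := (uniform_iff_minSq hβ hb hγ hρ0 hρW hsmall hrun hbox hpin).mp hC
  obtain ⟨m, hm, N, hlt⟩ := powerProfile_violating hM hp0 hp hρ C'
  exact absurd (hC' m hm N) (not_le.mpr hlt)

end Summit.QuantumFields.BalabanUV.Beta.RemainderExplicitHistoryDiagonalPowerProfile

end
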